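import Literature.AlgebraicGeometry.Frobenioids.ArithmeticFrobenioidModel
import Literature.AlgebraicGeometry.Frobenioids.ModelFrobenioidBaseChangeEquivalence
import HarnessLib

/-!
# Frobenioids I, Example 6.3: the arithmetic divisor data `(Φ, B, Div_B)` is FUNCTORIAL in isomorphisms of
# the fields — a natural family of ring isomorphisms over a functor of bases induces a morphism of model data
# with bijective components, hence an equivalence of the model Frobenioids over an equivalence of bases

Mochizuki, *The geometry of Frobenioids I: the general theory*, Kyushu J. Math. **62** (2008) 293–400, §6,
Example 6.3 p. 113 ("we obtain a monoid `Φ` on `D` … [functorial: pull-back of arithmetic divisors along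
`Spec L → Spec M`] … a natural homomorphism `B → Φ^gp`, `f ↦ div(f)`") [cite: MochizukiFrdI2008, Ex. 6.3 p.113];
§5, Theorem 5.2 (i) p. 100 (the model Frobenioid of data `(Φ, B, Div_B)`) [cite: MochizukiFrdI2008, Thm. 5.2(i) p.100]
and Corollary 5.4 p. 104 ("the horizontal arrows are equivalences") [cite: MochizukiFrdI2008, Cor. 5.4 p.104].

PROOF-ONLY file (cell abc-iut; seat abc-iut-w4-d109 gen 9, row C53ILIFT «COR53I-LIFTSALL@ARITH» — the L1 brick
behind the SURJECTIVITY half of [IUTchI] Cor. 5.3 (i) at the genuine arithmetic model).  abc-iut-L1-t3's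
divisor data of Example 6.3 (`arithDivisorFunctor F K : Spec L ↦ Φ(L)` = effective arithmetic divisors,
`unitsFunctor F K : Spec L ↦ L^×`, `divNatTrans F K : f ↦ div(f)`, `ArithmeticFrobenioidModel.lean`) lives on
`FinSubextCat F K` and is pulled back along any base functor `E : D ⥤ FinSubextCat F K` (abc-iut-L1-t4's
`ModelFrobenioid.divBRestrict`; this is how [IUTchI] Ex. 5.1 (ii)'s `ℱ^⊛(†𝒟^⊚)` over `ℬ(G_F)⁰` is built,
`GlobalDivisorData.arith`).  The three constituents are functorial in ARBITRARY ring homomorphisms of number fields,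
not only in `F`-algebra maps (`EffArithDivisor.pullback σ`, `Units.map σ`, and `σ^* div(f) = div(σ f)`,
`ArithDivisor.pullback_principalArithDivisor`, all in `ArithmeticDivisorsFunctor.lean`).  Hence:

* `exists_dataHomOver_of_ringEquiv` — for base functors `E₁ : D₁ ⥤ FinSubextCat F₁ K₁`, `E₂ : D₂ ⥤ FinSubextCat F₂ K₂`,
  a functor `T : D₁ ⥤ D₂` and a family of RING isomorphisms `ρ_A : L(E₁ A) ≃+* L(E₂ (T A))` that is natural
  (`ρ_A ∘ E₁(f) = E₂(T f) ∘ ρ_{A'}` on elements), there is a morphism of model data OVER `T`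
  (abc-iut-w5-d048's `ModelFrobenioid.DataHomOver`) between the restricted data, with components
  `η_A = ρ_A^*` on `Φ` and `β_A = ρ_A` on units — both BIJECTIVE;
* `exists_equivalence_over_of_ringEquiv` — if moreover `T` is an equivalence, the induced functor of model
  Frobenioids (abc-iut-w5-d137's `DataHomOver.functor_isEquivalence`, Cor. 5.4) is an equivalence `Ψ` lying over
  `T` ON THE NOSE: `Ψ ⋙ Base = Base ⋙ T`.

No `F`-linearity of the `ρ_A` is required — this is the point: a field automorphism of `F̃` moving `F` still acts
on the arithmetic Frobenioid `C_{F̃/F}` over the induced self-equivalence of the base.  0 `def`, no instance, no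
notation, no named fact; nothing here bears on [IUTchIII] Cor. 3.12.
-/

noncomputable section

namespace Literature.AlgebraicGeometry.Frobenioids

open CategoryTheory Opposite Function

universe v₁ v₂ u₁ u₂

namespace EffArithDivisor

variable {M : Type} [Field M] [NumberField M] {L : Type} [Field L] [NumberField L]

/-- Pull-back of effective arithmetic divisors along a ring ISOMORPHISM is bijective (inverse: pull-back along
the inverse isomorphism; functoriality `(τσ)^* = τ^* σ^*`, `id^* = id`). [cite: MochizukiFrdI2008, Ex. 6.3 p.113] -/
theorem pullback_bijective_of_ringEquiv (ρ : M ≃+* L) :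
    Bijective (EffArithDivisor.pullback (ρ.toRingHom : M →+* L)) := by
  have h1 : (ρ.symm.toRingHom : L →+* M).comp (ρ.toRingHom : M →+* L) = RingHom.id M :=
    RingHom.ext fun x => ρ.symm_apply_apply x
  have h2 : (ρ.toRingHom : M →+* L).comp (ρ.symm.toRingHom : L →+* M) = RingHom.id L :=
    RingHom.ext fun x => ρ.apply_symm_apply x
  refine bijective_iff_has_inverse.2 ⟨EffArithDivisor.pullback (ρ.symm.toRingHom : L →+* M), ?_, ?_⟩
  · intro D
    rw [← EffArithDivisor.pullback_comp, h1, EffArithDivisor.pullback_id]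
  · intro D
    rw [← EffArithDivisor.pullback_comp, h2, EffArithDivisor.pullback_id]

end EffArithDivisor

namespace ArithDivisorData

variable {F₁ : Type} [Field F₁] [NumberField F₁] {K₁ : Type} [Field K₁] [Algebra F₁ K₁]
variable {F₂ : Type} [Field F₂] [NumberField F₂] {K₂ : Type} [Field K₂] [Algebra F₂ K₂]
variable {D₁ : Type u₁} [Category.{v₁} D₁] {D₂ : Type u₂} [Category.{v₂} D₂]
  (E₁ : D₁ ⥤ FinSubextCat F₁ K₁) (E₂ : D₂ ⥤ FinSubextCat F₂ K₂) (T : D₁ ⥤ D₂)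
  (ρ : ∀ A : D₁, (E₁.obj A).L ≃+* (E₂.obj (T.obj A)).L)
  (hρ : ∀ ⦃A A' : D₁⦄ (f : A ⟶ A') (a : (E₁.obj A').L),
    ρ A ((E₁.map f).toAlgHom a) = (E₂.map (T.map f)).toAlgHom (ρ A' a))

/-- Units along a ring isomorphism: `Units.map ρ` is bijective. [cite: MochizukiFrdI2008, Ex. 6.3 p.113] -/
theorem unitsMap_bijective_of_ringEquiv {M : Type} [Field M] {L : Type} [Field L] (ρ : M ≃+* L) :
    Bijective (Units.map ρ.toRingHom.toMonoidHom) := by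
  refine bijective_iff_has_inverse.2 ⟨Units.map ρ.symm.toRingHom.toMonoidHom, ?_, ?_⟩
  · intro u
    exact Units.ext (ρ.symm_apply_apply (u : M))
  · intro u
    exact Units.ext (ρ.apply_symm_apply (u : L))

include hρ in
/-- **Example 6.3's divisor data is functorial in natural families of ring isomorphisms over a functor of
bases.**  For `E₁ : D₁ ⥤ FinSubextCat F₁ K₁`, `E₂ : D₂ ⥤ FinSubextCat F₂ K₂`, `T : D₁ ⥤ D₂` and ring isomorphisms
`ρ_A : L(E₁ A) ≃+* L(E₂ (T A))` natural in `A` (`ρ_A (E₁(f) a) = E₂(T f) (ρ_{A'} a)`), there is a morphism of model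
data over `T` between the restricted data `(Φ, B, div)|_{E₁}` and `(Φ, B, div)|_{E₂}` whose `Φ`-components are the
pull-backs `ρ_A^*` and whose unit components are `u ↦ ρ_A u`; both are bijective.  (`σ^* div(f) = div(σ f)`
supplies the compatibility with `Div_B`.) [cite: MochizukiFrdI2008, Ex. 6.3 p.113] -/
theorem exists_dataHomOver_of_ringEquiv :
    ∃ h : ModelFrobenioid.DataHomOver T
        (ModelFrobenioid.divBRestrict E₁ (arithDivisorFunctor F₁ K₁) (unitsFunctor F₁ K₁) (divNatTrans F₁ K₁))
        (ModelFrobenioid.divBRestrict E₂ (arithDivisorFunctor F₂ K₂) (unitsFunctor F₂ K₂) (divNatTrans F₂ K₂)),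
      (∀ (A : D₁) (x : Multiplicative (EffArithDivisor (E₁.obj A).L)),
        (h.η.app (op A)).hom x =
          AddMonoidHom.toMultiplicative (EffArithDivisor.pullback ((ρ A).toRingHom : _ →+* _)) x) ∧
      (∀ (A : D₁) (u : ((E₁.obj A).L)ˣ),
        (Units.val ((h.β.app (op A)).hom u) : (E₂.obj (T.obj A)).L) = ρ A u) ∧
      (∀ A : D₁, Bijective (h.η.app (op A)).hom) ∧ (∀ A : D₁, Bijective (h.β.app (op A)).hom) := by
  -- the `Φ`-components `ρ_A^*`
  let ηapp : ∀ A : D₁ᵒᵖ, (E₁.op ⋙ arithDivisorFunctor F₁ K₁).obj A ⟶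
      (T.op ⋙ (E₂.op ⋙ arithDivisorFunctor F₂ K₂)).obj A := fun A =>
    CommMonCat.ofHom (AddMonoidHom.toMultiplicative (EffArithDivisor.pullback ((ρ A.unop).toRingHom : _ →+* _)))
  have hηapp : ∀ (A : D₁ᵒᵖ) (x : Multiplicative (EffArithDivisor (E₁.obj A.unop).L)),
      (ηapp A).hom x = AddMonoidHom.toMultiplicative (EffArithDivisor.pullback ((ρ A.unop).toRingHom : _ →+* _)) x :=
    fun A x => rfl
  -- the unit components `ρ_A`
  let βapp : ∀ A : D₁ᵒᵖ, (E₁.op ⋙ unitsFunctor F₁ K₁).obj A ⟶ (T.op ⋙ (E₂.op ⋙ unitsFunctor F₂ K₂)).obj A :=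
    fun A => CommMonCat.ofHom (Units.map (ρ A.unop).toRingHom.toMonoidHom)
  have hβapp : ∀ (A : D₁ᵒᵖ) (u : ((E₁.obj A.unop).L)ˣ),
      (βapp A).hom u = Units.map (ρ A.unop).toRingHom.toMonoidHom u := fun A u => rfl
  have hβval : ∀ (A : D₁ᵒᵖ) (u : ((E₁.obj A.unop).L)ˣ),
      (Units.val ((βapp A).hom u) : (E₂.obj (T.obj A.unop)).L) = ρ A.unop u :=
    fun A u => rfl
  -- naturality of `η`: `ρ_A^* ∘ E₁(f)^* = E₂(T f)^* ∘ ρ_{A'}^*` from `ρ_A ∘ E₁(f) = E₂(T f) ∘ ρ_{A'}`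
  have hcompρ : ∀ ⦃A A' : D₁⦄ (f : A ⟶ A'),
      ((ρ A).toRingHom : _ →+* _).comp (E₁.map f).toAlgHom.toRingHom =
        (E₂.map (T.map f)).toAlgHom.toRingHom.comp ((ρ A').toRingHom : _ →+* _) :=
    fun A A' f => RingHom.ext fun a => hρ f a
  let η : E₁.op ⋙ arithDivisorFunctor F₁ K₁ ⟶ T.op ⋙ (E₂.op ⋙ arithDivisorFunctor F₂ K₂) :=
    { app := ηapp
      naturality := fun X Y f => by
        apply CommMonCat.hom_ext
        refine MonoidHom.ext fun x => ?_
        change (ηapp Y).hom (AddMonoidHom.toMultiplicative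
            (EffArithDivisor.pullback (E₁.map f.unop).toAlgHom.toRingHom) x) =
          AddMonoidHom.toMultiplicative (EffArithDivisor.pullback (E₂.map (T.map f.unop)).toAlgHom.toRingHom)
            ((ηapp X).hom x)
        rw [hηapp, hηapp]
        change Multiplicative.ofAdd (EffArithDivisor.pullback _
            (EffArithDivisor.pullback _ (Multiplicative.toAdd x))) =
          Multiplicative.ofAdd (EffArithDivisor.pullback _ (EffArithDivisor.pullback _ (Multiplicative.toAdd x)))
        rw [← EffArithDivisor.pullback_comp, ← EffArithDivisor.pullback_comp]
        exact congrArg (fun R => Multiplicative.ofAdd (EffArithDivisor.pullback R (Multiplicative.toAdd x)))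
          (hcompρ f.unop) }
  let β : E₁.op ⋙ unitsFunctor F₁ K₁ ⟶ T.op ⋙ (E₂.op ⋙ unitsFunctor F₂ K₂) :=
    { app := βapp
      naturality := fun X Y f => by
        apply CommMonCat.hom_ext
        refine MonoidHom.ext fun u => Units.ext ?_
        exact hρ f.unop (Units.val u) }
  refine ⟨{ η := η, β := β, comm := fun A u => ?_ }, fun A x => hηapp (op A) x, fun A u => hβval (op A) u,
    fun A => ?_, fun A => ?_⟩
  · -- `Div_B(ρ u) = (ρ^*)^gp (Div_B u)`: `σ^* div(f) = div(σ f)`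
    change MonGp.map (ηapp A).hom ((EffArithDivisor.gpEquiv (E₁.obj A.unop).L).symm
        (principalArithDivisorHom (E₁.obj A.unop).L u)) =
      (EffArithDivisor.gpEquiv (E₂.obj (T.obj A.unop)).L).symm
        (principalArithDivisorHom (E₂.obj (T.obj A.unop)).L ((βapp A).hom u))
    rw [hβapp]
    apply (EffArithDivisor.gpEquiv (E₂.obj (T.obj A.unop)).L).injective
    rw [MulEquiv.apply_symm_apply, EffArithDivisor.gpEquiv_apply]
    change EffArithDivisor.gpHom _ (MonGp.map (AddMonoidHom.toMultiplicative
        (EffArithDivisor.pullback ((ρ A.unop).toRingHom : _ →+* _))) _) = _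
    rw [EffArithDivisor.gpHom_map, ← EffArithDivisor.gpEquiv_apply, MulEquiv.apply_symm_apply,
      RingHom.toMonoidHom_eq_coe]
    exact congrArg Multiplicative.ofAdd
      (ArithDivisor.pullback_principalArithDivisor ((ρ A.unop).toRingHom : _ →+* _) u)
  · -- bijectivity of `η_A = ρ_A^*`
    change Bijective (ηapp (op A)).hom
    exact EffArithDivisor.pullback_bijective_of_ringEquiv (ρ A)
  · -- bijectivity of `β_A = ρ_A` on units
    change Bijective (βapp (op A)).hom
    exact unitsMap_bijective_of_ringEquiv (ρ A)

include hρ in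
/-- **… hence an equivalence of the model Frobenioids over an equivalence of bases** (Cor. 5.4 "the
horizontal arrows are equivalences", abc-iut-w5-d137's `DataHomOver.functor_isEquivalence`): if `T` is an
equivalence, the functor `h.functor` induced by the data morphism `h` of `exists_dataHomOver_of_ringEquiv`
(`(A, α) ↦ (T A, (ρ_A^*)^gp α)`, `(d, f, Div, u) ↦ (d, T f, ρ_A^* Div, ρ_A u)`; it lies over `T` ON THE NOSE,
`DataHomOver.functor_comp_baseFunctor`) is an equivalence of categories. [cite: MochizukiFrdI2008, Cor. 5.4 p.104] -/
theorem exists_dataHomOver_isEquivalence_of_ringEquiv [T.IsEquivalence] :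
    ∃ h : ModelFrobenioid.DataHomOver T
        (ModelFrobenioid.divBRestrict E₁ (arithDivisorFunctor F₁ K₁) (unitsFunctor F₁ K₁) (divNatTrans F₁ K₁))
        (ModelFrobenioid.divBRestrict E₂ (arithDivisorFunctor F₂ K₂) (unitsFunctor F₂ K₂) (divNatTrans F₂ K₂)),
      (∀ (A : D₁) (x : Multiplicative (EffArithDivisor (E₁.obj A).L)),
        (h.η.app (op A)).hom x =
          AddMonoidHom.toMultiplicative (EffArithDivisor.pullback ((ρ A).toRingHom : _ →+* _)) x) ∧
      (∀ (A : D₁) (u : ((E₁.obj A).L)ˣ),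
        (Units.val ((h.β.app (op A)).hom u) : (E₂.obj (T.obj A)).L) = ρ A u) ∧
      h.functor.IsEquivalence := by
  obtain ⟨h, hη, hβ, hηb, hβb⟩ := exists_dataHomOver_of_ringEquiv E₁ E₂ T ρ hρ
  exact ⟨h, hη, hβ, h.functor_isEquivalence hηb hβb⟩

include hρ in
/-- **An equivalence of arithmetic model Frobenioids over `T`**, packaged for consumers that only need the
base compatibility: for `T` an equivalence and `ρ` a natural family of ring isomorphisms of the fields, there is
an equivalence `Ψ : C(E₁) ⥲ C(E₂)` of the model Frobenioids of the restricted arithmetic divisor data with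
`Ψ ⋙ Base = Base ⋙ T` on the nose (and `deg_Fr` preserved). [cite: MochizukiFrdI2008, Cor. 5.4 p.104] -/
theorem exists_equivalence_over_of_ringEquiv [T.IsEquivalence] :
    ∃ Ψ : ModelFrobenioid (E₁.op ⋙ arithDivisorFunctor F₁ K₁) (E₁.op ⋙ unitsFunctor F₁ K₁)
          (ModelFrobenioid.divBRestrict E₁ (arithDivisorFunctor F₁ K₁) (unitsFunctor F₁ K₁) (divNatTrans F₁ K₁)) ≌
        ModelFrobenioid (E₂.op ⋙ arithDivisorFunctor F₂ K₂) (E₂.op ⋙ unitsFunctor F₂ K₂)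
          (ModelFrobenioid.divBRestrict E₂ (arithDivisorFunctor F₂ K₂) (unitsFunctor F₂ K₂) (divNatTrans F₂ K₂)),
      Ψ.functor ⋙ ModelFrobenioid.baseFunctor _ _ _ = ModelFrobenioid.baseFunctor _ _ _ ⋙ T ∧
      ∀ ⦃X Y⦄ (φ : X ⟶ Y), ModelFrobenioid.degFr (Ψ.functor.map φ) = ModelFrobenioid.degFr φ := by
  obtain ⟨h, -, -, hE⟩ := exists_dataHomOver_isEquivalence_of_ringEquiv E₁ E₂ T ρ hρ
  haveI := hE
  exact ⟨h.functor.asEquivalence, h.functor_comp_baseFunctor, fun X Y φ => h.degFr_functor_map φ⟩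

end ArithDivisorData

end Literature.AlgebraicGeometry.Frobenioids

end
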